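import Literature.Probability.LatticeModels.KCModifiedDirichlet
import Literature.Probability.LatticeModels.InnerFacesHoleFree
import Literature.Probability.LatticeModels.BoxDirichlet
import HarnessLib

/-!
# Power decay of the harmonic measure with killing near the end of a straight piece of the cut

Topic `Literature/Probability/LatticeModels`. The estimate behind the last step of the proof of
Chelkak–Smirnov 2012, Theorem 6.1 (eq. (6.10)) and its Remark 6.3, in the Kadanoff–Ceva / boundary
modification rendering of the tree (`KCModifiedDirichlet.lean`): the function `V^δ` (the harmonic
measure, with killing at the frozen sides, of the DEEP part of the boundary) is small near the END
`p` of the contour, where the contour is a straight lattice segment ending on the boundary and the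
deep part of the boundary is far away. Chelkak–Smirnov obtain `V^δ(v) = O(μ^β)` at distance `μ` from
`p` from the weak Beurling estimate ("Lemma (WeakBeurling) gives `ω^δ(v; (s̃ p̃); D) = O(μ^β)`
uniformly on `∂R_μ`"). In the boundary-modification rendering the walk is killed softly (rate `κ`)
at the frozen sides, and we derive the same power law from the PLAIN weak Beurling estimate of the
tree (`latticeHM_compl_sqBox_le_of_cutPath`, cut along the straight piece of the contour) by a
multi-scale induction, using only:

* `V ≤ 1`, `V = 0` off the finite set `D` of plaquettes, `V` plain-harmonic at the plaquettes of
  `D` whose four sides touch (`T`), and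
* the **contraction** `V(g) ≤ θ₀ · m` whenever `V ≤ m` at the touching neighbours of a plaquette
  `g ∈ D` within range having a non-touching side, `θ₀ = 3/(3+κ) < 0.79` (`kcModHM_le_contract`: the
  cemetery there is dead, i.e. not deep);
* cuts: lattice walks from the base plaquette `c₀` out of the boxes `sqBox c₀ R`, `R < R₀`, avoiding
  `T` (along the frozen bonds at `c₀`, or the straight run of the contour).

Main statements:

* `le_layerCake` — **the layered two-constant bound**: a subharmonic
  function on a finite `T` whose boundary values are bounded by a nondecreasing step function of the
  sup-distance to `c₀` is bounded inside by the corresponding combination of harmonic measures;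
* `straightWalk` and its support — the cut path;
* `endTheta` (`θ₀`), `endGap` (`d_β = 1 - 2^{-β/2}`), `endDecayExp` (`γ`), `endDecayConst` (`A`) —
  explicit universal constants from `beurlingExp`, `beurlingConst` and `κ`, with their arithmetic
  (`end_decay_numeric`, `end_geom_bound`);
* **`end_decay_of_cuts`** — under the hypotheses above (cuts from `c₀` out of every `sqBox c₀ R`,
  `R < R₀`, avoiding the all-touch plaquettes of `D`), for every `r ≤ R₀` and every
  `w ∈ D ∩ sqBox c₀ r`: `V w ≤ A ((r+1)/(R₀+1))^γ`; **`end_decay`** — the same with the straight run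
  of the contour as the cuts.

Everything is proved; no named fact.

## References

* D. Chelkak, S. Smirnov, Invent. Math. 189 (2012) = arXiv:0910.2045: proof of Thm. 6.1 (the
  estimate of `V^δ` near `p^δ`, eq. (6.10)), Remark 6.3 [ChelkakSmirnov2012Ising].
* S. Smirnov, Ann. of Math. 172 (2010), App. B, Lemma B.2 (weak Beurling) [Smirnov2010].
-/

noncomputable section

open Finset Set SimpleGraph

namespace Literature.Probability.LatticeModels

open WeakBeurling

/-! ### The layered two-constant bound -/

/-- **The layered two-constant bound (layer-cake form of the maximum principle).** Let `h` be
subharmonic on the finite set `T`, let `s 0 ≤ s 1 ≤ …` be radii and `B 0 ≤ B 1 ≤ … ≤ B K` levels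
with `h ≤ B K` on `∂T` and `h ≤ B k` on `∂T ∩ sqBox c₀ (s k)` for `k ≤ K`. Then on `T`,
`h ≤ B 0 + ∑_{k < K} (B (k+1) - B k) · ω_T(·, (sqBox c₀ (s k))ᶜ)`. [cite: Smirnov2010, Appendix B, proof of Lemma B.3 (two-constant bounds)] -/
theorem le_layerCake {T : Set (Site 2)} (hT : T.Finite) {h : Site 2 → ℝ} (hh : IsLatticeSubharmonicOn h T)
    (c₀ : Site 2) {s : ℕ → ℕ} (hs : Monotone s) {B : ℕ → ℝ} (hB : Monotone B) (K : ℕ)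
    (hbdK : ∀ w ∈ latticeOuterBoundary T, h w ≤ B K)
    (hbd : ∀ w ∈ latticeOuterBoundary T, ∀ k ≤ K, w ∈ sqBox c₀ (s k) → h w ≤ B k) :
    ∀ z ∈ T, h z ≤ B 0 + ∑ k ∈ Finset.range K, (B (k + 1) - B k) * latticeHM T (sqBox c₀ (s k))ᶜ z := by
  classical
  have _ := hs
  set G : Site 2 → ℝ := fun z => B 0 + ∑ k ∈ Finset.range K, (B (k + 1) - B k) * latticeHM T (sqBox c₀ (s k))ᶜ z with hG
  have hGsup : IsLatticeSuperharmonicOn G T := by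
    intro v hv
    have e : G = fun z => (fun z => ∑ k ∈ Finset.range K, (fun k z => (B (k + 1) - B k) * latticeHM T (sqBox c₀ (s k))ᶜ z) k z) z + B 0 := by
      funext z; simp only [hG]; ring
    rw [e, latticeLaplacian_add_const, latticeLaplacian_finset_sum]
    refine le_of_eq (Finset.sum_eq_zero fun k _ => ?_)
    rw [latticeLaplacian_const_mul, latticeHM_harmonicOn hT _ v hv, mul_zero]
  intro z hz
  have key := le_of_sub_super_of_boundary hT hh hGsup (c := 0) (fun w hw => ?_) z hz
  · simpa using key
  rw [add_zero]
  simp only [hG]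
  -- at a boundary point: the first index `j ≤ K` with `w ∈ sqBox c₀ (s j)`, if any
  by_cases hex : ∃ k ≤ K, w ∈ sqBox c₀ (s k)
  · obtain ⟨j, hjK, hwj, hmin⟩ : ∃ j ≤ K, w ∈ sqBox c₀ (s j) ∧ ∀ k < j, w ∉ sqBox c₀ (s k) := by
      rcases hex with ⟨k₀, hk₀, hwk₀⟩
      have hP : ∃ k, w ∈ sqBox c₀ (s k) := ⟨k₀, hwk₀⟩
      refine ⟨Nat.find hP, (Nat.find_min' hP hwk₀).trans hk₀, Nat.find_spec hP, fun k hk => Nat.find_min hP hk⟩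
    have hwle := hbd w hw j hjK hwj
    have hsplit : B 0 + ∑ k ∈ Finset.range j, (B (k + 1) - B k) = B j := by
      rw [Finset.sum_range_sub]; ring
    calc h w ≤ B j := hwle
      _ = B 0 + ∑ k ∈ Finset.range j, (B (k + 1) - B k) * latticeHM T (sqBox c₀ (s k))ᶜ w := by
          rw [← hsplit]
          congr 1
          refine Finset.sum_congr rfl fun k hk => ?_
          rw [latticeHM_of_not_mem_of_mem hT hw.1 (Set.mem_compl (hmin k (Finset.mem_range.1 hk))), mul_one]
      _ ≤ B 0 + ∑ k ∈ Finset.range K, (B (k + 1) - B k) * latticeHM T (sqBox c₀ (s k))ᶜ w := by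
          have hsub : Finset.range j ⊆ Finset.range K := Finset.range_mono hjK
          rw [← Finset.sum_sdiff hsub]
          have : 0 ≤ ∑ k ∈ Finset.range K \ Finset.range j, (B (k + 1) - B k) * latticeHM T (sqBox c₀ (s k))ᶜ w :=
            Finset.sum_nonneg fun k _ => mul_nonneg (sub_nonneg.2 (hB (Nat.le_succ k))) (latticeHM_mem_Icc hT _ w).1
          linarith
  · push Not at hex
    have hwle := hbdK w hw
    have hall : ∀ k ∈ Finset.range K, latticeHM T (sqBox c₀ (s k))ᶜ w = 1 := fun k hk =>
      latticeHM_of_not_mem_of_mem hT hw.1 (Set.mem_compl (hex k (Finset.mem_range.1 hk).le))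
    rw [Finset.sum_congr rfl fun k hk => by rw [hall k hk, mul_one], Finset.sum_range_sub]
    linarith

/-! ### Straight cut paths -/

/-- **The straight walk** of `n` steps from `c₀` in direction `e_k`. [folklore] -/
def straightWalk (c₀ : Site 2) (k : Fin 4) : (n : ℕ) → (zdGraph 2).Walk c₀ (c₀ + n • cornerUnit k)
  | 0 => (Walk.nil : (zdGraph 2).Walk c₀ c₀).copy rfl (by simp)
  | n + 1 => ((straightWalk c₀ k n).append
      (Walk.cons (zdGraph_adj_add_cornerUnit (c₀ + n • cornerUnit k) k) Walk.nil)).copy rfl (by rw [succ_nsmul, add_assoc])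

/-- The support of the straight walk consists of the points `c₀ + i e_k`, `i ≤ n`. [folklore] -/
theorem mem_support_straightWalk {c₀ : Site 2} {k : Fin 4} {n : ℕ} {z : Site 2}
    (hz : z ∈ (straightWalk c₀ k n).support) : ∃ i ≤ n, z = c₀ + i • cornerUnit k := by
  induction n with
  | zero =>
    simp only [straightWalk, Walk.support_copy, Walk.support_nil, List.mem_singleton] at hz
    exact ⟨0, le_rfl, by simp [hz]⟩
  | succ n ih =>
    simp only [straightWalk, Walk.support_copy, Walk.support_append, Walk.support_cons, Walk.support_nil,
      List.tail_cons, List.mem_append, List.mem_singleton] at hz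
    rcases hz with hz | hz
    · obtain ⟨i, hi, rfl⟩ := ih hz
      exact ⟨i, hi.trans (Nat.le_succ n), rfl⟩
    · exact ⟨n + 1, le_rfl, by rw [hz, succ_nsmul, add_assoc]⟩

/-- The endpoint of a straight walk of `n ≥ R + 1` steps lies outside `sqBox c₀ R`. [folklore] -/
theorem straightWalk_end_not_mem_sqBox (c₀ : Site 2) (k : Fin 4) {n R : ℕ} (h : R + 1 ≤ n) :
    c₀ + n • cornerUnit k ∉ sqBox c₀ R := by
  intro hmem
  rw [mem_sqBox] at hmem
  rw [add_nsmul_cornerUnit_apply, add_nsmul_cornerUnit_apply, add_sub_cancel_left, add_sub_cancel_left] at hmem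
  have hn : (R : ℤ) + 1 ≤ n := by exact_mod_cast h
  fin_cases k <;> simp [cornerUnit] at hmem <;> omega

/-! ### The constants of the decay -/

/-- The contraction factor at a boundary plaquette with dead cemetery, `θ₀ = 3/(3+κ)`. [cite: ChelkakSmirnov2012Ising, proof of Thm. 6.1] -/
def endTheta : ℝ := 3 / (3 + modKappa)

/-- `0 < θ₀`. [folklore] -/
theorem endTheta_pos : 0 < endTheta := by
  unfold endTheta; have := modKappa_pos; positivity

/-- `θ₀ ≤ 15/19 (< 0.79)`. [folklore] -/
theorem endTheta_le : endTheta ≤ 15 / 19 := by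
  unfold endTheta
  have hk := four_fifths_le_modKappa
  rw [div_le_div_iff₀ (by linarith [modKappa_pos]) (by norm_num)]
  linarith

/-- The gap of the geometric series of the induction, `d_β = 1 - 2^{-β/2} ∈ (0, 1)`. [folklore] -/
def endGap : ℝ := 1 - (2 : ℝ) ^ (-(beurlingExp / 2))

/-- `0 < d_β`. [folklore] -/
theorem endGap_pos : 0 < endGap := by
  unfold endGap
  have : (2 : ℝ) ^ (-(beurlingExp / 2)) < 1 :=
    Real.rpow_lt_one_of_one_lt_of_neg (by norm_num) (by linarith [beurlingExp_pos])
  linarith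

/-- `d_β ≤ 1`. [folklore] -/
theorem endGap_le_one : endGap ≤ 1 := by
  unfold endGap
  have : 0 ≤ (2 : ℝ) ^ (-(beurlingExp / 2)) := Real.rpow_nonneg (by norm_num) _
  linarith

/-- **The decay exponent** `γ = min (β/2, 1/20, d_β/(20 C))`. [cite: ChelkakSmirnov2012Ising, proof of Thm. 6.1, eq. (6.10)] -/
def endDecayExp : ℝ := min (beurlingExp / 2) (min (1 / 20) (endGap / (20 * beurlingConst)))

/-- `0 < γ`. [folklore] -/
theorem endDecayExp_pos : 0 < endDecayExp := by
  unfold endDecayExp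
  refine lt_min (by linarith [beurlingExp_pos]) (lt_min (by norm_num) ?_)
  exact div_pos endGap_pos (by linarith [beurlingConst_pos])

/-- `γ ≤ β/2`. [folklore] -/
theorem endDecayExp_le_half_beurlingExp : endDecayExp ≤ beurlingExp / 2 := min_le_left _ _

/-- `γ ≤ β`. [folklore] -/
theorem endDecayExp_le_beurlingExp : endDecayExp ≤ beurlingExp :=
  endDecayExp_le_half_beurlingExp.trans (by linarith [beurlingExp_pos])

/-- `γ ≤ 1/20`. [folklore] -/
theorem endDecayExp_le : endDecayExp ≤ 1 / 20 := (min_le_right _ _).trans (min_le_left _ _)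

/-- `γ ≤ d_β / (20 C)`. [folklore] -/
theorem endDecayExp_le_gap : endDecayExp ≤ endGap / (20 * beurlingConst) := (min_le_right _ _).trans (min_le_right _ _)

/-- **The decay constant** `A = 20 C 4^β` (`≥ 20`). [cite: ChelkakSmirnov2012Ising, proof of Thm. 6.1, eq. (6.10)] -/
def endDecayConst : ℝ := 20 * beurlingConst * (4 : ℝ) ^ beurlingExp

/-- `20 ≤ A`. [folklore] -/
theorem endDecayConst_ge : 20 ≤ endDecayConst := by
  unfold endDecayConst
  have h1 := one_le_beurlingConst
  have h2 : (1 : ℝ) ≤ (4 : ℝ) ^ beurlingExp := Real.one_le_rpow (by norm_num) beurlingExp_pos.le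
  nlinarith

/-- `0 < A`. [folklore] -/
theorem endDecayConst_pos : 0 < endDecayConst := lt_of_lt_of_le (by norm_num) endDecayConst_ge

/-- `2^x ≤ 1 + x` for `0 ≤ x ≤ 1` (Bernoulli). [folklore] -/
theorem two_rpow_le_one_add {x : ℝ} (h0 : 0 ≤ x) (h1 : x ≤ 1) : (2 : ℝ) ^ x ≤ 1 + x := by
  have h := rpow_one_add_le_one_add_mul_self (show (-1 : ℝ) ≤ 1 by norm_num) h0 h1
  norm_num at h
  linarith

/-- `2^γ ≤ 21/20`. [folklore] -/
theorem two_rpow_endDecayExp_le : (2 : ℝ) ^ endDecayExp ≤ 21 / 20 := by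
  have := two_rpow_le_one_add endDecayExp_pos.le (endDecayExp_le.trans (by norm_num))
  linarith [endDecayExp_le]

/-- `2^{2γ} ≤ 11/10`. [folklore] -/
theorem two_rpow_two_mul_endDecayExp_le : (2 : ℝ) ^ (2 * endDecayExp) ≤ 11 / 10 := by
  have h2 : 2 * endDecayExp ≤ 1 / 10 := by linarith [endDecayExp_le]
  have := two_rpow_le_one_add (by linarith [endDecayExp_pos]) (h2.trans (by norm_num))
  linarith

/-- `2^γ - 1 ≤ γ`. [folklore] -/
theorem two_rpow_endDecayExp_sub_one_le : (2 : ℝ) ^ endDecayExp - 1 ≤ endDecayExp := by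
  have := two_rpow_le_one_add endDecayExp_pos.le (endDecayExp_le.trans (by norm_num))
  linarith

/-- **The numeric heart of the induction**: with `θ₀ ≤ 15/19`, `2^{2γ} ≤ 11/10`,
`(2^γ - 1) C 2^{2γ-β}/d_β ≤ 11/200` and `C 4^β = A/20`, the bracket
`θ₀ A (2^{2γ} + (2^γ-1) C 2^{2γ-β}/d_β) + C 4^β` is at most `A`. [folklore] -/
theorem end_decay_numeric :
    endTheta * endDecayConst * ((2 : ℝ) ^ (2 * endDecayExp) +
        ((2 : ℝ) ^ endDecayExp - 1) * beurlingConst * ((2 : ℝ) ^ (2 * endDecayExp - beurlingExp) / endGap)) +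
      beurlingConst * (4 : ℝ) ^ beurlingExp ≤ endDecayConst := by
  have h3 : beurlingConst * (4 : ℝ) ^ beurlingExp = endDecayConst / 20 := by unfold endDecayConst; ring
  set γ := endDecayExp with hγ
  set A := endDecayConst with hA
  set C := beurlingConst with hC
  set β := beurlingExp with hβ
  set θ := endTheta with hθ
  have hγ0 : 0 < γ := endDecayExp_pos
  have hA0 : 0 < A := endDecayConst_pos
  have hC1 : 1 ≤ C := one_le_beurlingConst
  have hβ0 : 0 < β := beurlingExp_pos
  have hθ0 : 0 < θ := endTheta_pos
  have hθ1 : θ ≤ 15 / 19 := endTheta_le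
  have hgap0 := endGap_pos
  have h22γ := two_rpow_two_mul_endDecayExp_le
  have h2pow : (2 : ℝ) ^ (2 * γ - β) ≤ (2 : ℝ) ^ (2 * γ) :=
    Real.rpow_le_rpow_of_exponent_le (by norm_num) (by linarith)
  have hmid : ((2 : ℝ) ^ γ - 1) * C * ((2 : ℝ) ^ (2 * γ - β) / endGap) ≤ 11 / 200 := by
    have hγle : (2 : ℝ) ^ γ - 1 ≤ endGap / (20 * C) := two_rpow_endDecayExp_sub_one_le.trans endDecayExp_le_gap
    have hpos1 : 0 ≤ (2 : ℝ) ^ γ - 1 := by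
      have : (1 : ℝ) ≤ (2 : ℝ) ^ γ := Real.one_le_rpow (by norm_num) hγ0.le
      linarith
    have hfrac : (2 : ℝ) ^ (2 * γ - β) / endGap ≤ (11 / 10) / endGap :=
      div_le_div_of_nonneg_right (h2pow.trans h22γ) hgap0.le
    have hfrac0 : 0 ≤ (2 : ℝ) ^ (2 * γ - β) / endGap := div_nonneg (Real.rpow_nonneg (by norm_num) _) hgap0.le
    calc ((2 : ℝ) ^ γ - 1) * C * ((2 : ℝ) ^ (2 * γ - β) / endGap)
        ≤ (endGap / (20 * C)) * C * ((11 / 10) / endGap) := by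
          apply mul_le_mul (mul_le_mul_of_nonneg_right hγle (by linarith)) hfrac hfrac0
          exact mul_nonneg (div_nonneg hgap0.le (by linarith)) (by linarith)
      _ = 11 / 200 := by field_simp; ring
  have h1 : (2 : ℝ) ^ (2 * γ) + ((2 : ℝ) ^ γ - 1) * C * ((2 : ℝ) ^ (2 * γ - β) / endGap) ≤ 231 / 200 := by linarith
  have hθA : 0 ≤ θ * A := mul_nonneg hθ0.le hA0.le
  have h2 : θ * A * ((2 : ℝ) ^ (2 * γ) + ((2 : ℝ) ^ γ - 1) * C * ((2 : ℝ) ^ (2 * γ - β) / endGap)) ≤ θ * A * (231 / 200) :=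
    mul_le_mul_of_nonneg_left h1 hθA
  have h2' : θ * A * (231 / 200) ≤ 15 / 19 * A * (231 / 200) := by nlinarith
  linarith

/-- **The geometric series of the induction**: `∑_{j<n} 2^{(j+2)γ} 2^{-(j+1)β} ≤ 2^{2γ-β}/d_β`. [folklore] -/
theorem end_geom_bound (n : ℕ) :
    ∑ j ∈ Finset.range n, (2 : ℝ) ^ (((j : ℝ) + 2) * endDecayExp) * (2 : ℝ) ^ (-(((j : ℝ) + 1) * beurlingExp)) ≤
      (2 : ℝ) ^ (2 * endDecayExp - beurlingExp) / endGap := by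
  set γ := endDecayExp
  set β := beurlingExp
  set q : ℝ := (2 : ℝ) ^ (γ - β) with hq
  have hq0 : 0 ≤ q := Real.rpow_nonneg (by norm_num) _
  have hqle : q ≤ (2 : ℝ) ^ (-(β / 2)) :=
    Real.rpow_le_rpow_of_exponent_le (by norm_num) (by linarith [endDecayExp_le_half_beurlingExp])
  have hq1 : q < 1 := lt_of_le_of_lt hqle (by have := endGap_pos; unfold endGap at this; linarith)
  have hterm : ∀ j : ℕ, (2 : ℝ) ^ (((j : ℝ) + 2) * γ) * (2 : ℝ) ^ (-(((j : ℝ) + 1) * β)) =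
      (2 : ℝ) ^ (2 * γ - β) * q ^ j := by
    intro j
    rw [hq, ← Real.rpow_natCast, ← Real.rpow_mul (by norm_num), ← Real.rpow_add (by norm_num),
      ← Real.rpow_add (by norm_num)]
    ring_nf
  simp_rw [hterm, ← Finset.mul_sum]
  have hgeom : ∑ j ∈ Finset.range n, q ^ j ≤ 1 / (1 - q) := by
    have hqn : 0 ≤ q ^ n := pow_nonneg hq0 n
    have h1q : 0 < 1 - q := by linarith
    have e : ∑ j ∈ Finset.range n, q ^ j = (1 - q ^ n) / (1 - q) := by
      rw [geom_sum_eq hq1.ne n, show q ^ n - 1 = -(1 - q ^ n) by ring, show q - 1 = -(1 - q) by ring,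
        neg_div_neg_eq]
    rw [e]
    exact div_le_div_of_nonneg_right (by linarith) h1q.le
  have hden : endGap ≤ 1 - q := by unfold endGap; linarith
  have hgap := endGap_pos
  calc (2 : ℝ) ^ (2 * γ - β) * ∑ j ∈ Finset.range n, q ^ j
      ≤ (2 : ℝ) ^ (2 * γ - β) * (1 / (1 - q)) := mul_le_mul_of_nonneg_left hgeom (Real.rpow_nonneg (by norm_num) _)
    _ ≤ (2 : ℝ) ^ (2 * γ - β) * (1 / endGap) := by
        apply mul_le_mul_of_nonneg_left _ (Real.rpow_nonneg (by norm_num) _)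
        exact one_div_le_one_div_of_le hgap hden
    _ = (2 : ℝ) ^ (2 * γ - β) / endGap := by ring

/-! ### The induction -/

/-- The scales of the induction: `s k + 1 = 2^{k+1} (r+1)` and `s k ≥ 2r+1`. [folklore] -/
theorem scale_facts (r k : ℕ) : (2 ^ (k + 1) * (r + 1) - 1 : ℕ) + 1 = 2 ^ (k + 1) * (r + 1) ∧
    2 * r + 1 ≤ 2 ^ (k + 1) * (r + 1) - 1 := by
  have h1 : 1 ≤ 2 ^ (k + 1) * (r + 1) := Nat.one_le_iff_ne_zero.2 (by positivity)
  have h2 : 2 * (r + 1) ≤ 2 ^ (k + 1) * (r + 1) := Nat.mul_le_mul_right _ (by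
    calc 2 = 2 ^ 1 := by norm_num
      _ ≤ 2 ^ (k + 1) := Nat.pow_le_pow_right (by norm_num) (by omega))
  omega

/-- The decay profile `φ r = ((r+1)/(R₀+1))^γ`. [folklore] -/
def endProfile (R₀ r : ℕ) : ℝ := (((r : ℝ) + 1) / ((R₀ : ℝ) + 1)) ^ endDecayExp

/-- `φ r > 0`. [folklore] -/
theorem endProfile_pos (R₀ r : ℕ) : 0 < endProfile R₀ r := Real.rpow_pos_of_pos (by positivity) _

/-- `φ` is nondecreasing. [folklore] -/
theorem endProfile_mono (R₀ : ℕ) {r r' : ℕ} (h : r ≤ r') : endProfile R₀ r ≤ endProfile R₀ r' := by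
  unfold endProfile
  refine Real.rpow_le_rpow (by positivity) ?_ endDecayExp_pos.le
  apply div_le_div_of_nonneg_right _ (by positivity)
  have : (r : ℝ) ≤ r' := by exact_mod_cast h
  linarith

/-- `φ r ≤ 1` for `r ≤ R₀`. [folklore] -/
theorem endProfile_le_one {R₀ r : ℕ} (h : r ≤ R₀) : endProfile R₀ r ≤ 1 :=
  Real.rpow_le_one (by positivity) ((div_le_one (by positivity)).2 (by exact_mod_cast Nat.succ_le_succ h)) endDecayExp_pos.le

/-- Doubling along the scales: `φ (2^j (r+1) - 1) = 2^{jγ} φ r`. [folklore] -/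
theorem endProfile_scale (R₀ r j : ℕ) : endProfile R₀ (2 ^ j * (r + 1) - 1) = (2 : ℝ) ^ ((j : ℝ) * endDecayExp) * endProfile R₀ r := by
  have h1 : (((2 ^ j * (r + 1) - 1 : ℕ) : ℝ) + 1) = (2 : ℝ) ^ (j : ℝ) * ((r : ℝ) + 1) := by
    have : 1 ≤ 2 ^ j * (r + 1) := Nat.one_le_iff_ne_zero.2 (by positivity)
    rw [Nat.cast_sub this]
    push_cast
    rw [Real.rpow_natCast]
    ring
  unfold endProfile
  rw [h1, mul_div_assoc, Real.mul_rpow (by positivity) (by positivity), ← Real.rpow_mul (by norm_num)]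

/-- `φ (2^{j+1}(r+1)) ≤ 2^{(j+2)γ} φ r`. [folklore] -/
theorem endProfile_le_scale (R₀ r j : ℕ) : endProfile R₀ (2 ^ (j + 1) * (r + 1)) ≤ (2 : ℝ) ^ (((j : ℝ) + 2) * endDecayExp) * endProfile R₀ r := by
  have h1 : endProfile R₀ (2 ^ (j + 1) * (r + 1)) ≤ endProfile R₀ (2 ^ (j + 2) * (r + 1) - 1) := endProfile_mono R₀ (by
    have : 2 ^ (j + 1) * (r + 1) + 1 ≤ 2 ^ (j + 2) * (r + 1) := by
      rw [show 2 ^ (j + 2) = 2 * 2 ^ (j + 1) by ring]; nlinarith [Nat.one_le_two_pow (n := j + 1)]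
    omega)
  rw [endProfile_scale R₀ r (j + 2)] at h1
  push_cast at h1
  exact h1

/-- `φ (2^{j+2}(r+1)) ≤ 2^γ φ (2^{j+1}(r+1))`. [folklore] -/
theorem endProfile_double (R₀ r j : ℕ) : endProfile R₀ (2 ^ (j + 2) * (r + 1)) ≤ (2 : ℝ) ^ endDecayExp * endProfile R₀ (2 ^ (j + 1) * (r + 1)) := by
  have h1 : (((2 ^ (j + 2) * (r + 1) : ℕ) : ℝ) + 1) / ((R₀ : ℝ) + 1) ≤
      2 * ((((2 ^ (j + 1) * (r + 1) : ℕ) : ℝ) + 1) / ((R₀ : ℝ) + 1)) := by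
    rw [mul_div_assoc']
    apply div_le_div_of_nonneg_right _ (by positivity)
    push_cast; ring_nf; nlinarith [pow_pos (show (0:ℝ) < 2 by norm_num) j]
  unfold endProfile
  calc (((((2 ^ (j + 2) * (r + 1) : ℕ) : ℝ) + 1) / ((R₀ : ℝ) + 1)) ^ endDecayExp)
      ≤ (2 * ((((2 ^ (j + 1) * (r + 1) : ℕ) : ℝ) + 1) / ((R₀ : ℝ) + 1))) ^ endDecayExp :=
        Real.rpow_le_rpow (by positivity) h1 endDecayExp_pos.le
    _ = (2 : ℝ) ^ endDecayExp * ((((2 ^ (j + 1) * (r + 1) : ℕ) : ℝ) + 1) / ((R₀ : ℝ) + 1)) ^ endDecayExp :=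
        Real.mul_rpow (by norm_num) (by positivity)

/-- **The inductive step at an all-touch plaquette** (Case B of `end_decay`): if the bound
`V ≤ A φ r'` holds on `sqBox c₀ r'` for all `2r+1 ≤ r' ≤ R₀`, then it holds at every all-touch
plaquette `w ∈ D ∩ sqBox c₀ r` (`2r + 2 ≤ R₀`), by the layer cake and the weak Beurling estimate
along cuts from `c₀` avoiding the all-touch plaquettes of `D`. [cite: ChelkakSmirnov2012Ising, proof of Thm. 6.1, eq. (6.10); Smirnov2010, Lemma B.2] -/
theorem end_decay_step (Λ : Finset (Site 2)) {D : Finset (Site 2)} {V : Site 2 → ℝ}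
    (hV1 : ∀ x, V x ≤ 1) (hVD : ∀ x ∉ D, V x = 0)
    (hharm : ∀ f ∈ D, (∀ j : Fin 4, SideTouch Λ f j) → latticeLaplacian V f = 0)
    {c₀ : Site 2} {R₀ : ℕ}
    (hcontr : ∀ g ∈ D, g ∈ sqBox c₀ R₀ → (∃ j : Fin 4, ¬ SideTouch Λ g j) → ∀ m : ℝ, 0 ≤ m →
      (∀ j : Fin 4, SideTouch Λ g j → V (sideNbr g j) ≤ m) → V g ≤ endTheta * m)
    (hcut : ∀ R : ℕ, R < R₀ → ∃ (d : Site 2) (q : (zdGraph 2).Walk c₀ d), d ∉ sqBox c₀ R ∧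
      ∀ z ∈ q.support, ¬ (z ∈ D ∧ ∀ j : Fin 4, SideTouch Λ z j))
    {r : ℕ} (hr : 2 * r + 2 ≤ R₀)
    (SUP : ∀ r' : ℕ, 2 * r + 1 ≤ r' → r' ≤ R₀ → ∀ x ∈ sqBox c₀ (r' : ℤ), V x ≤ endDecayConst * endProfile R₀ r')
    {w : Site 2} (hwD : w ∈ D) (hwT : ∀ j : Fin 4, SideTouch Λ w j) (hwr : w ∈ sqBox c₀ r) :
    V w ≤ endDecayConst * endProfile R₀ r := by
  classical
  set γ := endDecayExp with hγ
  set A := endDecayConst with hA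
  set C := beurlingConst with hC
  set β := beurlingExp with hβ
  set θ := endTheta with hθ
  set φ : ℕ → ℝ := endProfile R₀ with hφ
  have hγ0 : 0 < γ := endDecayExp_pos
  have hA0 : 0 < A := endDecayConst_pos
  have hC1 : 1 ≤ C := one_le_beurlingConst
  have hβ0 : 0 < β := beurlingExp_pos
  have hθ0 : 0 < θ := endTheta_pos
  have hR : (0 : ℝ) < (R₀ : ℝ) + 1 := by positivity
  have hφpos : ∀ n, 0 < φ n := endProfile_pos R₀
  -- the set of all-touch plaquettes of `D`
  set T : Set (Site 2) := {f | f ∈ D ∧ ∀ j : Fin 4, SideTouch Λ f j} with hTdef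
  have hTfin : T.Finite := (D.finite_toSet).subset fun f hf => hf.1
  have hVT : IsLatticeHarmonicOn V T := fun f hf => hharm f hf.1 hf.2
  have hwT' : w ∈ T := ⟨hwD, hwT⟩
  -- the largest `K'` with `2^{K'+1}(r+1) ≤ R₀`
  set P : ℕ → Prop := fun K' => 2 ^ (K' + 1) * (r + 1) ≤ R₀ with hPdef
  have hP0 : P 0 := by simp only [hPdef]; omega
  have hbdd : ∀ K' : ℕ, P K' → K' ≤ R₀ := by
    intro K' hK'
    have h1 : K' + 1 ≤ 2 ^ (K' + 1) := (Nat.lt_two_pow_self).le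
    have h2 : 2 ^ (K' + 1) ≤ 2 ^ (K' + 1) * (r + 1) := Nat.le_mul_of_pos_right _ (by omega)
    simp only [hPdef] at hK'
    omega
  set K' := Nat.findGreatest P R₀ with hK'def
  have hK' : P K' := Nat.findGreatest_spec (Nat.zero_le R₀) hP0
  have hK'max : ∀ K'', P K'' → K'' ≤ K' := fun K'' h => Nat.le_findGreatest (hbdd K'' h) h
  -- scales and levels
  set s : ℕ → ℕ := fun j => 2 ^ (j + 1) * (r + 1) - 1 with hsdef
  have hs_add : ∀ j, s j + 1 = 2 ^ (j + 1) * (r + 1) := fun j => (scale_facts r j).1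
  have hs_ge : ∀ j, 2 * r + 1 ≤ s j := fun j => (scale_facts r j).2
  have hsmono : Monotone s := by
    intro i j hij
    simp only [hsdef]
    have : 2 ^ (i + 1) * (r + 1) ≤ 2 ^ (j + 1) * (r + 1) :=
      Nat.mul_le_mul_right _ (Nat.pow_le_pow_right (by norm_num) (by omega))
    omega
  have hsR : ∀ j ≤ K', s j ≤ R₀ - 1 := by
    intro j hj
    have h1 := hsmono hj
    have h2 : s K' + 1 ≤ R₀ := by rw [hs_add]; exact hK'
    omega
  set Bf : ℕ → ℝ := fun j => θ * (A * φ (2 ^ (j + 1) * (r + 1))) with hBf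
  have hBfmono : Monotone Bf := by
    intro i j hij
    simp only [hBf]
    have : φ (2 ^ (i + 1) * (r + 1)) ≤ φ (2 ^ (j + 1) * (r + 1)) :=
      endProfile_mono R₀ (Nat.mul_le_mul_right _ (Nat.pow_le_pow_right (by norm_num) (by omega)))
    exact mul_le_mul_of_nonneg_left (mul_le_mul_of_nonneg_left this hA0.le) hθ0.le
  have hBfnn : ∀ j, 0 ≤ Bf j := fun j => by simp only [hBf]; exact mul_nonneg hθ0.le (mul_nonneg hA0.le (hφpos _).le)
  set B : ℕ → ℝ := fun j => if j ≤ K' then Bf j else max 1 (Bf K') with hBdef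
  have hBmono : Monotone B := by
    intro i j hij
    simp only [hBdef]
    by_cases hi : i ≤ K' <;> by_cases hj : j ≤ K'
    · rw [if_pos hi, if_pos hj]; exact hBfmono hij
    · rw [if_pos hi, if_neg hj]; exact (hBfmono hi).trans (le_max_right _ _)
    · omega
    · rw [if_neg hi, if_neg hj]
  -- boundary bounds on `∂T`
  have hbdK : ∀ g ∈ latticeOuterBoundary T, V g ≤ B (K' + 1) := by
    intro g _
    simp only [hBdef, if_neg (Nat.not_succ_le_self K')]
    exact (hV1 g).trans (le_max_left _ _)
  have hbd : ∀ g ∈ latticeOuterBoundary T, ∀ j ≤ K' + 1, g ∈ sqBox c₀ (s j) → V g ≤ B j := by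
    intro g hg j hj hgj
    rcases Nat.lt_or_ge j (K' + 1) with hjK | hjK
    · have hjK' : j ≤ K' := Nat.lt_succ_iff.1 hjK
      simp only [hBdef, if_pos hjK']
      by_cases hgD : g ∈ D
      · have hgT : ∃ i : Fin 4, ¬ SideTouch Λ g i := by
          by_contra hall; push Not at hall; exact hg.1 ⟨hgD, hall⟩
        have hsj1 : s j + 1 ≤ R₀ := by have := hsR j hjK'; omega
        have hm : ∀ i : Fin 4, SideTouch Λ g i → V (sideNbr g i) ≤ A * φ (s j + 1) := by
          intro i _
          refine SUP (s j + 1) (by have := hs_ge j; omega) hsj1 _ ?_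
          have h1 : sideNbr g i ∈ sqBox c₀ ((s j : ℤ) + 1) :=
            mem_sqBox_succ_of_adj hgj (by rw [sideNbr]; exact zdGraph_adj_add_cornerUnit g (i + 3))
          exact_mod_cast h1
        have hc := hcontr g hgD (sqBox_mono c₀ (by have := hsR j hjK'; omega) hgj) hgT (A * φ (s j + 1))
          (mul_nonneg hA0.le (hφpos _).le) hm
        simp only [hBf]
        rw [hs_add j] at hc
        exact hc
      · rw [hVD g hgD]; exact hBfnn j
    · have : j = K' + 1 := le_antisymm hj hjK
      subst this
      exact hbdK g hg
  -- the layer cake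
  have hLC := le_layerCake hTfin hVT.subharmonicOn c₀ hsmono hBmono (K' + 1) hbdK hbd w hwT'
  -- weak Beurling along the cut
  have hWB : ∀ j ≤ K', latticeHM T (sqBox c₀ (s j))ᶜ w ≤ C * (((r : ℝ) + 1) / ((s j : ℝ) + 1)) ^ β := by
    intro j hj
    have hlt : s j < R₀ := by have := hsR j hj; omega
    obtain ⟨d, q, hd, hq⟩ := hcut (s j) hlt
    exact latticeHM_compl_sqBox_le_of_cutPath hTfin q hd (fun z hz hzT => hq z hz hzT) hwT' hwr
  have hωle : ∀ j ≤ K', latticeHM T (sqBox c₀ (s j))ᶜ w ≤ C * (2 : ℝ) ^ (-(((j : ℝ) + 1) * β)) := by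
    intro j hj
    refine (hWB j hj).trans (le_of_eq ?_)
    congr 1
    have e1 : ((s j : ℝ) + 1) = (2 : ℝ) ^ ((j : ℝ) + 1) * ((r : ℝ) + 1) := by
      have h' : ((s j : ℕ) : ℝ) + 1 = ((2 ^ (j + 1) * (r + 1) : ℕ) : ℝ) := by exact_mod_cast hs_add j
      rw [h']; push_cast; rw [← Real.rpow_natCast]; push_cast; ring
    have e2 : ((r : ℝ) + 1) / ((2 : ℝ) ^ ((j : ℝ) + 1) * ((r : ℝ) + 1)) = (2 : ℝ) ^ (-((j : ℝ) + 1)) := by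
      rw [Real.rpow_neg (by norm_num)]
      field_simp
    rw [e1, e2, ← Real.rpow_mul (by norm_num)]
    ring_nf
  have hω0 : ∀ j, 0 ≤ latticeHM T (sqBox c₀ (s j))ᶜ w := fun j => (latticeHM_mem_Icc hTfin _ w).1
  have hω1 : ∀ j, latticeHM T (sqBox c₀ (s j))ᶜ w ≤ 1 := fun j => (latticeHM_mem_Icc hTfin _ w).2
  -- split the layer-cake sum at `K'`
  rw [Finset.sum_range_succ] at hLC
  have hBj : ∀ j < K', B (j + 1) - B j = Bf (j + 1) - Bf j := by
    intro j hj; simp only [hBdef, if_pos (Nat.succ_le_of_lt hj), if_pos hj.le]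
  have hB0 : B 0 = Bf 0 := by simp only [hBdef, if_pos (Nat.zero_le K')]
  -- increments
  have hpos1 : 0 ≤ (2 : ℝ) ^ γ - 1 := by
    have : (1 : ℝ) ≤ (2 : ℝ) ^ γ := Real.one_le_rpow (by norm_num) hγ0.le
    linarith
  have hθA : 0 ≤ θ * A := mul_nonneg hθ0.le hA0.le
  have hincr : ∀ j : ℕ, Bf (j + 1) - Bf j ≤ θ * A * φ r * ((2 : ℝ) ^ (((j : ℝ) + 2) * γ) * ((2 : ℝ) ^ γ - 1)) := by
    intro j
    have h1 : φ (2 ^ (j + 2) * (r + 1)) ≤ (2 : ℝ) ^ γ * φ (2 ^ (j + 1) * (r + 1)) := endProfile_double R₀ r j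
    have h2 : φ (2 ^ (j + 1) * (r + 1)) ≤ (2 : ℝ) ^ (((j : ℝ) + 2) * γ) * φ r := endProfile_le_scale R₀ r j
    simp only [hBf]
    rw [show j + 1 + 1 = j + 2 by ring]
    calc θ * (A * φ (2 ^ (j + 2) * (r + 1))) - θ * (A * φ (2 ^ (j + 1) * (r + 1)))
        = θ * A * (φ (2 ^ (j + 2) * (r + 1)) - φ (2 ^ (j + 1) * (r + 1))) := by ring
      _ ≤ θ * A * (((2 : ℝ) ^ γ - 1) * φ (2 ^ (j + 1) * (r + 1))) := by
          apply mul_le_mul_of_nonneg_left _ hθA; linarith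
      _ ≤ θ * A * (((2 : ℝ) ^ γ - 1) * ((2 : ℝ) ^ (((j : ℝ) + 2) * γ) * φ r)) := by
          apply mul_le_mul_of_nonneg_left _ hθA
          exact mul_le_mul_of_nonneg_left h2 hpos1
      _ = θ * A * φ r * ((2 : ℝ) ^ (((j : ℝ) + 2) * γ) * ((2 : ℝ) ^ γ - 1)) := by ring
  have hincr0 : ∀ j : ℕ, 0 ≤ θ * A * φ r * ((2 : ℝ) ^ (((j : ℝ) + 2) * γ) * ((2 : ℝ) ^ γ - 1)) := fun j =>
    mul_nonneg (mul_nonneg hθA (hφpos r).le) (mul_nonneg (Real.rpow_nonneg (by norm_num) _) hpos1)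
  -- the sum over `j < K'`
  have hsumK : ∑ j ∈ Finset.range K', (B (j + 1) - B j) * latticeHM T (sqBox c₀ (s j))ᶜ w ≤
      θ * A * φ r * ((2 : ℝ) ^ γ - 1) * C * ((2 : ℝ) ^ (2 * γ - β) / endGap) := by
    calc ∑ j ∈ Finset.range K', (B (j + 1) - B j) * latticeHM T (sqBox c₀ (s j))ᶜ w
        ≤ ∑ j ∈ Finset.range K', (θ * A * φ r * ((2 : ℝ) ^ (((j : ℝ) + 2) * γ) * ((2 : ℝ) ^ γ - 1))) *
            (C * (2 : ℝ) ^ (-(((j : ℝ) + 1) * β))) := by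
          refine Finset.sum_le_sum fun j hj => ?_
          have hjK : j < K' := Finset.mem_range.1 hj
          rw [hBj j hjK]
          exact mul_le_mul (hincr j) (hωle j hjK.le) (hω0 j) (hincr0 j)
      _ = θ * A * φ r * ((2 : ℝ) ^ γ - 1) * C *
            ∑ j ∈ Finset.range K', (2 : ℝ) ^ (((j : ℝ) + 2) * γ) * (2 : ℝ) ^ (-(((j : ℝ) + 1) * β)) := by
          rw [Finset.mul_sum]; refine Finset.sum_congr rfl fun j _ => ?_; ring
      _ ≤ θ * A * φ r * ((2 : ℝ) ^ γ - 1) * C * ((2 : ℝ) ^ (2 * γ - β) / endGap) := by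
          apply mul_le_mul_of_nonneg_left (end_geom_bound K')
          have := hφpos r
          exact mul_nonneg (mul_nonneg (mul_nonneg hθA this.le) hpos1) (by linarith)
  -- the last term
  have hlast : (B (K' + 1) - B K') * latticeHM T (sqBox c₀ (s K'))ᶜ w ≤ C * (4 : ℝ) ^ β * φ r := by
    have hBK1 : B (K' + 1) - B K' ≤ 1 := by
      simp only [hBdef, if_neg (Nat.not_succ_le_self K'), if_pos le_rfl]
      have := hBfnn K'
      rcases le_total 1 (Bf K') with h | h
      · rw [max_eq_right h]; linarith
      · rw [max_eq_left h]; linarith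
    have hBd : 0 ≤ B (K' + 1) - B K' := sub_nonneg.2 (hBmono (Nat.le_succ K'))
    have h1 : (B (K' + 1) - B K') * latticeHM T (sqBox c₀ (s K'))ᶜ w ≤ latticeHM T (sqBox c₀ (s K'))ᶜ w := by
      have := hω0 K'
      calc (B (K' + 1) - B K') * latticeHM T (sqBox c₀ (s K'))ᶜ w ≤ 1 * latticeHM T (sqBox c₀ (s K'))ᶜ w :=
            mul_le_mul_of_nonneg_right hBK1 this
        _ = _ := one_mul _
    refine h1.trans ((hWB K' le_rfl).trans ?_)
    have hmax : R₀ < 2 ^ (K' + 2) * (r + 1) := by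
      by_contra hle
      push Not at hle
      have := hK'max (K' + 1) (by simp only [hPdef]; exact hle)
      omega
    have hNpos : (0 : ℝ) < ((2 ^ (K' + 1) * (r + 1) : ℕ) : ℝ) := by positivity
    have e1 : ((s K' : ℝ) + 1) = ((2 ^ (K' + 1) * (r + 1) : ℕ) : ℝ) := by exact_mod_cast hs_add K'
    have hRN : (R₀ : ℝ) + 1 ≤ 2 * ((2 ^ (K' + 1) * (r + 1) : ℕ) : ℝ) := by
      have h' : R₀ + 1 ≤ 2 * (2 ^ (K' + 1) * (r + 1)) := by
        rw [show 2 * (2 ^ (K' + 1) * (r + 1)) = 2 ^ (K' + 2) * (r + 1) by ring]; exact hmax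
      exact_mod_cast h'
    have hq : ((r : ℝ) + 1) / ((s K' : ℝ) + 1) ≤ 4 * (((r : ℝ) + 1) / ((R₀ : ℝ) + 1)) := by
      rw [e1, mul_div_assoc', div_le_div_iff₀ hNpos hR]
      have hr0 : (0 : ℝ) ≤ (r : ℝ) + 1 := by positivity
      nlinarith
    have hq0 : 0 ≤ ((r : ℝ) + 1) / ((s K' : ℝ) + 1) := by positivity
    have hrR : ((r : ℝ) + 1) / ((R₀ : ℝ) + 1) ≤ 1 := (div_le_one hR).2 (by
      have : ((2 * r + 2 : ℕ) : ℝ) ≤ (R₀ : ℝ) := by exact_mod_cast hr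
      push_cast at this; linarith)
    calc C * (((r : ℝ) + 1) / ((s K' : ℝ) + 1)) ^ β ≤ C * (4 * (((r : ℝ) + 1) / ((R₀ : ℝ) + 1))) ^ β := by
          apply mul_le_mul_of_nonneg_left _ (by linarith)
          exact Real.rpow_le_rpow hq0 hq hβ0.le
      _ = C * (4 : ℝ) ^ β * (((r : ℝ) + 1) / ((R₀ : ℝ) + 1)) ^ β := by
          rw [Real.mul_rpow (by norm_num) (by positivity)]; ring
      _ ≤ C * (4 : ℝ) ^ β * φ r := by
          apply mul_le_mul_of_nonneg_left _ (by positivity)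
          exact Real.rpow_le_rpow_of_exponent_ge (by positivity) hrR endDecayExp_le_beurlingExp
  -- `B 0 ≤ θ A φ r 2^{2γ}`
  have hB0le : B 0 ≤ θ * A * φ r * (2 : ℝ) ^ (2 * γ) := by
    rw [hB0]
    simp only [hBf]
    have h : φ (2 ^ (0 + 1) * (r + 1)) ≤ (2 : ℝ) ^ ((((0 : ℕ) : ℝ) + 2) * γ) * φ r := endProfile_le_scale R₀ r 0
    have e0 : (((0 : ℕ) : ℝ) + 2) * γ = 2 * γ := by push_cast; ring
    rw [e0] at h
    calc θ * (A * φ (2 ^ (0 + 1) * (r + 1))) = θ * A * φ (2 ^ (0 + 1) * (r + 1)) := by ring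
      _ ≤ θ * A * ((2 : ℝ) ^ (2 * γ) * φ r) := mul_le_mul_of_nonneg_left h hθA
      _ = θ * A * φ r * (2 : ℝ) ^ (2 * γ) := by ring
  -- total
  have htotal : V w ≤ φ r * (θ * A * ((2 : ℝ) ^ (2 * γ) + ((2 : ℝ) ^ γ - 1) * C * ((2 : ℝ) ^ (2 * γ - β) / endGap)) +
      C * (4 : ℝ) ^ β) := by
    have e : φ r * (θ * A * ((2 : ℝ) ^ (2 * γ) + ((2 : ℝ) ^ γ - 1) * C * ((2 : ℝ) ^ (2 * γ - β) / endGap)) +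
        C * (4 : ℝ) ^ β) = θ * A * φ r * (2 : ℝ) ^ (2 * γ) +
        θ * A * φ r * ((2 : ℝ) ^ γ - 1) * C * ((2 : ℝ) ^ (2 * γ - β) / endGap) + C * (4 : ℝ) ^ β * φ r := by ring
    rw [e]
    linarith [hLC, hsumK, hlast, hB0le]
  have hnum := end_decay_numeric
  calc V w ≤ φ r * (θ * A * ((2 : ℝ) ^ (2 * γ) + ((2 : ℝ) ^ γ - 1) * C * ((2 : ℝ) ^ (2 * γ - β) / endGap)) +
      C * (4 : ℝ) ^ β) := htotal
    _ ≤ φ r * A := mul_le_mul_of_nonneg_left hnum (hφpos r).le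
    _ = A * φ r := by ring

/-- **Power decay of the harmonic measure with killing near a boundary point far from the live
cemetery** (Chelkak–Smirnov 2012, proof of Thm. 6.1, the estimate `V^δ = O(μ^β)` near `p^δ`, in the
boundary-modification rendering; general cut form). Let `D` be a finite set of plaquettes,
`V : Site 2 → ℝ` with `V ≤ 1`, `V = 0` off `D`, `V` plain-harmonic at the plaquettes of `D` whose four
sides touch `Λ`, and satisfying the contraction `V g ≤ θ₀ · m` whenever `g ∈ D ∩ sqBox c₀ R₀` has a
non-touching side and `V ≤ m` (`m ≥ 0`) at its touching neighbours. Suppose that for every `R < R₀`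
some lattice walk from `c₀` leaves `sqBox c₀ R` avoiding the all-touch plaquettes of `D` (e.g. along
frozen bonds, `exists_plaqWalk_along`, or along the contour). Then for `r ≤ R₀` and
`w ∈ D ∩ sqBox c₀ r`, `V w ≤ A ((r+1)/(R₀+1))^γ`. [cite: ChelkakSmirnov2012Ising, proof of Thm. 6.1, eq. (6.10); Smirnov2010, Lemma B.2] -/
theorem end_decay_of_cuts (Λ : Finset (Site 2)) {D : Finset (Site 2)} {V : Site 2 → ℝ}
    (hV1 : ∀ x, V x ≤ 1) (hVD : ∀ x ∉ D, V x = 0)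
    (hharm : ∀ f ∈ D, (∀ j : Fin 4, SideTouch Λ f j) → latticeLaplacian V f = 0)
    {c₀ : Site 2} {R₀ : ℕ}
    (hcontr : ∀ g ∈ D, g ∈ sqBox c₀ R₀ → (∃ j : Fin 4, ¬ SideTouch Λ g j) → ∀ m : ℝ, 0 ≤ m →
      (∀ j : Fin 4, SideTouch Λ g j → V (sideNbr g j) ≤ m) → V g ≤ endTheta * m)
    (hcut : ∀ R : ℕ, R < R₀ → ∃ (d : Site 2) (q : (zdGraph 2).Walk c₀ d), d ∉ sqBox c₀ R ∧
      ∀ z ∈ q.support, ¬ (z ∈ D ∧ ∀ j : Fin 4, SideTouch Λ z j)) :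
    ∀ r : ℕ, r ≤ R₀ → ∀ w ∈ D, w ∈ sqBox c₀ r → V w ≤ endDecayConst * endProfile R₀ r := by
  classical
  set A := endDecayConst with hA
  set θ := endTheta with hθ
  set φ : ℕ → ℝ := endProfile R₀ with hφ
  have hγ0 : 0 < endDecayExp := endDecayExp_pos
  have hA0 : 0 < A := endDecayConst_pos
  have hθ0 : 0 < θ := endTheta_pos
  have hθ1 : θ ≤ 15 / 19 := endTheta_le
  have hR : (0 : ℝ) < (R₀ : ℝ) + 1 := by positivity
  have hφpos : ∀ n, 0 < φ n := endProfile_pos R₀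
  -- strong downward induction on `r`, via `d = R₀ - r`
  suffices H : ∀ d : ℕ, ∀ r : ℕ, R₀ - r ≤ d → r ≤ R₀ → ∀ w ∈ D, w ∈ sqBox c₀ r → V w ≤ A * φ r by
    intro r hr w hw hwr; exact H (R₀ - r) r le_rfl hr w hw hwr
  intro d
  induction d using Nat.strong_induction_on with
  | _ d ih =>
  intro r hrd hrR w hwD hwr
  -- base: `2r + 2 > R₀`
  by_cases hbase : R₀ ≤ 2 * r + 1
  · have h1 : (1 : ℝ) / 2 ≤ ((r : ℝ) + 1) / ((R₀ : ℝ) + 1) := by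
      rw [div_le_div_iff₀ (by norm_num) hR]
      have : (R₀ : ℝ) ≤ 2 * r + 1 := by exact_mod_cast hbase
      linarith
    have h2 : (1 : ℝ) / 2 ≤ φ r := by
      calc (1 : ℝ) / 2 = (1 / 2) ^ (1 : ℝ) := by norm_num
        _ ≤ (1 / 2 : ℝ) ^ endDecayExp := Real.rpow_le_rpow_of_exponent_ge (by norm_num) (by norm_num) (endDecayExp_le.trans (by norm_num))
        _ ≤ φ r := Real.rpow_le_rpow (by norm_num) h1 hγ0.le
    calc V w ≤ 1 := hV1 w
      _ ≤ A * φ r := by nlinarith [endDecayConst_ge]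
  push Not at hbase
  -- the bound at all scales `r' ≥ 2r + 1`
  have SUP : ∀ r' : ℕ, 2 * r + 1 ≤ r' → r' ≤ R₀ → ∀ x ∈ sqBox c₀ (r' : ℤ), V x ≤ A * φ r' := by
    intro r' h1 h2 x hx
    by_cases hxD : x ∈ D
    · exact ih (R₀ - r') (by omega) r' le_rfl h2 x hxD hx
    · rw [hVD x hxD]; exact mul_nonneg hA0.le (hφpos r').le
  by_cases hwT : ∀ j : Fin 4, SideTouch Λ w j
  · -- Case B
    exact end_decay_step Λ hV1 hVD hharm hcontr hcut (by omega) SUP hwD hwT hwr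
  · -- Case A: contraction
    push Not at hwT
    have hm : ∀ j : Fin 4, SideTouch Λ w j → V (sideNbr w j) ≤ A * φ (2 * r + 1) := by
      intro j _
      refine SUP (2 * r + 1) le_rfl (by omega) _ ?_
      have h1 : sideNbr w j ∈ sqBox c₀ ((r : ℤ) + 1) :=
        mem_sqBox_succ_of_adj hwr (by rw [sideNbr]; exact zdGraph_adj_add_cornerUnit w (j + 3))
      exact sqBox_mono c₀ (by push_cast; omega) h1
    have hc := hcontr w hwD (sqBox_mono c₀ (by exact_mod_cast hrR) hwr) hwT (A * φ (2 * r + 1))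
      (mul_nonneg hA0.le (hφpos _).le) hm
    have hφ2 : φ (2 * r + 1) = (2 : ℝ) ^ endDecayExp * φ r := by
      have h := endProfile_scale R₀ r 1
      rw [show 2 ^ 1 * (r + 1) - 1 = 2 * r + 1 by omega] at h
      simpa using h
    rw [hφ2] at hc
    have h2γ := two_rpow_endDecayExp_le
    have h2γ0 : 0 ≤ (2 : ℝ) ^ endDecayExp := Real.rpow_nonneg (by norm_num) _
    have hθ2 : θ * (2 : ℝ) ^ endDecayExp ≤ 1 := by nlinarith
    have hAφ : 0 ≤ A * φ r := mul_nonneg hA0.le (hφpos r).le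
    calc V w ≤ θ * (A * ((2 : ℝ) ^ endDecayExp * φ r)) := hc
      _ = (θ * (2 : ℝ) ^ endDecayExp) * (A * φ r) := by ring
      _ ≤ 1 * (A * φ r) := mul_le_mul_of_nonneg_right hθ2 hAφ
      _ = A * φ r := one_mul _

/-- **Power decay of the harmonic measure with killing near the end of a straight piece of the
cut**: the form of `end_decay_of_cuts` in which the cuts are the straight run `c₀ + i e_k`,
`i ≤ R₀ + 2`, of the contour, assumed to avoid the all-touch plaquettes of `D`.
[cite: ChelkakSmirnov2012Ising, proof of Thm. 6.1, eq. (6.10); Smirnov2010, Lemma B.2] -/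
theorem end_decay (Λ : Finset (Site 2)) {D : Finset (Site 2)} {V : Site 2 → ℝ}
    (hV1 : ∀ x, V x ≤ 1) (hVD : ∀ x ∉ D, V x = 0)
    (hharm : ∀ f ∈ D, (∀ j : Fin 4, SideTouch Λ f j) → latticeLaplacian V f = 0)
    {c₀ : Site 2} {R₀ : ℕ}
    (hcontr : ∀ g ∈ D, g ∈ sqBox c₀ R₀ → (∃ j : Fin 4, ¬ SideTouch Λ g j) → ∀ m : ℝ, 0 ≤ m →
      (∀ j : Fin 4, SideTouch Λ g j → V (sideNbr g j) ≤ m) → V g ≤ endTheta * m)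
    {k : Fin 4} (hcol : ∀ i : ℕ, i ≤ R₀ + 2 → ¬ (c₀ + i • cornerUnit k ∈ D ∧ ∀ j : Fin 4, SideTouch Λ (c₀ + i • cornerUnit k) j)) :
    ∀ r : ℕ, r ≤ R₀ → ∀ w ∈ D, w ∈ sqBox c₀ r → V w ≤ endDecayConst * endProfile R₀ r := by
  refine end_decay_of_cuts Λ hV1 hVD hharm hcontr fun R hR => ?_
  refine ⟨c₀ + (R + 1) • cornerUnit k, straightWalk c₀ k (R + 1), straightWalk_end_not_mem_sqBox c₀ k le_rfl,
    fun z hz hzT => ?_⟩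
  obtain ⟨i, hi, rfl⟩ := mem_support_straightWalk hz
  exact hcol i (by omega) hzT

end Literature.Probability.LatticeModels
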